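import Summits.CriticalPhenomena.PercolationContinuityZ3.Theorems.PercAnnulusCrossingIICGluedAnnuliDensity
import HarnessLib

/-!
# Glued annuli: the density bound holds conditionally on the inside (lane RSW3, p1 gen 18)

builds on p205010 (kernel theorem, internal audit signed; external expert review pending) — NOT used in this file.

RSW3 lane (LANE 3 `prim-rsw3`), seat `prim-rsw3-p1` (gen 18).  Helper file (`--supports stmt-CriticalPhenomena-4575`);
no definitions, no sorries.  Memo `run/shared/lean/prim/rsw3/P1-QM.md` §31.9.

The quenched form of `…IICGluedAnnuliDensity`: under `CU⁺_l(c)` (every `d`, `p`; `l ≥ 2`; nested scales `a_i ≥ 1`, `l·a_i + 1 ≤ a_{i+1}`),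
for every index `j` and EVERY measurable event `G` determined by the pairs of `Λ(a_j − 1)` (anything the cluster did inside), the number
`N = #{i < k : U(a_{j+i}, l·a_{j+i}) glued}` of glued annuli among the next `k` scales satisfies

* **`iicMeasure_real_inter_count_annulusUniq_le`** — `ν(G ∩ {N ≤ m}) ≤ 2^m (1 − c/2)^k · ν(G)` for every finite measure `ν` with Kesten's IIC
  limit property (the level-set MGF bound `measureReal_count_le_two_pow_mul_pow` run under `ν(· ∩ G)`, fed by gluing given the inside);
* **`real_siteToBoundary_inter_inter_count_annulusUniq_le`** — finite volume, every `n`: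
  `P_p({0 ↔ ∂ⁱⁿΛ(n)} ∩ G ∩ {N ≤ m}) ≤ 2^m (1 − c/2)^k · P_p({0 ↔ ∂ⁱⁿΛ(n)} ∩ G)`.
Whatever the inner cluster looks like, at least a fraction `c/2` of the following annuli are glued, up to an exponentially small probability:
the glued scales behave like a renewal structure for the IIC seen from the origin.
References: H. Kesten, PTRF 73 (1986) §2; G. Grimmett, *Percolation* (1999), (11.70)–(11.72).
-/

noncomputable section

namespace Summit.CriticalPhenomena.PercolationContinuityZ3.Theorems.Crossing

open MeasureTheory Filter Topology Literature.Probability.Percolation Literature.Probability.LatticeModels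
open Literature.Probability.Percolation.DCT16
open Summit.CriticalPhenomena.PercolationContinuityZ3.Theorems.SurfaceTension

variable {d : ℕ}

/-- **QUENCHED DENSITY OF GLUED SCALES UNDER THE IIC**: under `CU⁺_l(c)`, for every finite measure `ν` with Kesten's IIC limit property, every
`j`, every measurable `G` determined by the pairs of `Λ(a_j − 1)` and all `k, m`:
**`ν(G ∩ {#{i<k : U(a_{j+i}, la_{j+i})} ≤ m}) ≤ 2^m (1 − c/2)^k ν(G)`**. [cite: Kesten1986, §2] -/
theorem iicMeasure_real_inter_count_annulusUniq_le (p : unitInterval) {l : ℕ} (hl : 2 ≤ l) {c : ℝ}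
    (hCU : ∀ a : ℕ, 1 ≤ a → ∀ E : Set (BondConfig (Site d)), IsUpperSet E → MeasurableSet E →
      c * (bondPercolation (zdGraph d) p).real E ≤ (bondPercolation (zdGraph d) p).real (E ∩
        {ω : BondConfig (Site d) | ∀ t ∈ innerBoundary (zdGraph d) (box d a), ∀ s ∈ innerBoundary (zdGraph d) (box d (l * a)),
        ∀ t' ∈ innerBoundary (zdGraph d) (box d a), ∀ s' ∈ innerBoundary (zdGraph d) (box d (l * a)),
        ω ∈ openConnIn (↑((box d (l * a) \ box d a) ∪ innerBoundary (zdGraph d) (box d a)) : Set (Site d)) t s →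
        ω ∈ openConnIn (↑((box d (l * a) \ box d a) ∪ innerBoundary (zdGraph d) (box d a)) : Set (Site d)) t' s' →
        ω ∈ openConnIn (↑((box d (l * a) \ box d a) ∪ innerBoundary (zdGraph d) (box d a)) : Set (Site d)) s s'}))
    (a : ℕ → ℕ) (ha1 : ∀ i, 1 ≤ a i) (hnest : ∀ i, l * a i + 1 ≤ a (i + 1))
    {ν : Measure (BondConfig (Site d))} [IsFiniteMeasure ν]
    (hν : ∀ (F : Finset (Sym2 (Site d))) (E : Set (BondConfig (Site d))), MeasurableSet E → DeterminedBy E ↑F →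
      Tendsto (fun n : ℕ => (bondPercolation (zdGraph d) p).real (E ∩ siteToBoundary d n) / oneArmProb d p n)
        atTop (𝓝 (ν.real E))) (j : ℕ) {G : Set (BondConfig (Site d))}
    (hG : DeterminedBy G (↑((box d (a j - 1)).sym2) : Set (Sym2 (Site d)))) (hGm : MeasurableSet G) (k m : ℕ) :
    ν.real (G ∩ {ω | (∑ i ∈ Finset.range k, ({ω : BondConfig (Site d) | ∀ t ∈ innerBoundary (zdGraph d) (box d (a (j + i))), ∀ s ∈ innerBoundary (zdGraph d) (box d (l * a (j + i))),
        ∀ t' ∈ innerBoundary (zdGraph d) (box d (a (j + i))), ∀ s' ∈ innerBoundary (zdGraph d) (box d (l * a (j + i))),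
        ω ∈ openConnIn (↑((box d (l * a (j + i)) \ box d (a (j + i))) ∪ innerBoundary (zdGraph d) (box d (a (j + i)))) : Set (Site d)) t s →
        ω ∈ openConnIn (↑((box d (l * a (j + i)) \ box d (a (j + i))) ∪ innerBoundary (zdGraph d) (box d (a (j + i)))) : Set (Site d)) t' s' →
        ω ∈ openConnIn (↑((box d (l * a (j + i)) \ box d (a (j + i))) ∪ innerBoundary (zdGraph d) (box d (a (j + i)))) : Set (Site d)) s s'} : Set (BondConfig (Site d))).indicator (fun _ => (1 : ℕ)) ω) ≤ m}) ≤ 2 ^ m * (1 - c / 2) ^ k * ν.real G := by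
  set U : ℕ → Set (BondConfig (Site d)) := fun i => {ω : BondConfig (Site d) | ∀ t ∈ innerBoundary (zdGraph d) (box d (a (j + i))), ∀ s ∈ innerBoundary (zdGraph d) (box d (l * a (j + i))),
        ∀ t' ∈ innerBoundary (zdGraph d) (box d (a (j + i))), ∀ s' ∈ innerBoundary (zdGraph d) (box d (l * a (j + i))),
        ω ∈ openConnIn (↑((box d (l * a (j + i)) \ box d (a (j + i))) ∪ innerBoundary (zdGraph d) (box d (a (j + i)))) : Set (Site d)) t s →
        ω ∈ openConnIn (↑((box d (l * a (j + i)) \ box d (a (j + i))) ∪ innerBoundary (zdGraph d) (box d (a (j + i)))) : Set (Site d)) t' s' →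
        ω ∈ openConnIn (↑((box d (l * a (j + i)) \ box d (a (j + i))) ∪ innerBoundary (zdGraph d) (box d (a (j + i)))) : Set (Site d)) s s'} with hUdef
  -- `c ≤ 1`
  have hc1 : c ≤ 1 := by
    have h := hCU 1 le_rfl Set.univ isUpperSet_univ MeasurableSet.univ
    rw [probReal_univ, mul_one, Set.univ_inter] at h
    exact h.trans measureReal_le_one
  have hamono : Monotone a := monotone_nat_of_le_succ fun i => by nlinarith [hnest i, ha1 i]
  have hla : ∀ i i', i < i' → l * a i + 1 ≤ a i' := fun i i' hii' => (hnest i).trans (hamono (Nat.succ_le_of_lt hii'))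
  have hUm : ∀ i, MeasurableSet (U i) := fun i =>
    measurableSet_of_isLocalEvent_holds (isLocalEvent_annulusUniq (d := d) (by nlinarith [ha1 (j + i)]))
  have hUdet : ∀ i' i, i < i' → DeterminedBy (U i) (↑((box d (a (j + i') - 1)).sym2) : Set (Sym2 (Site d))) := by
    intro i' i hii'
    have h1 : l * a (j + i) ≤ a (j + i') - 1 := by have := hla (j + i) (j + i') (by omega); omega
    exact (determinedBy_annulusUniq (a (j + i)) (l * a (j + i)) (sym2_annulus_subset_sym2_box (by nlinarith [ha1 (j + i)]))).mono
      (Finset.coe_subset.2 (Finset.sym2_mono (box_mono d h1)))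
  have hNm : ∀ i', Measurable fun ω : BondConfig (Site d) => ∑ i ∈ Finset.range i', (U i).indicator (fun _ => (1 : ℕ)) ω :=
    fun i' => Finset.measurable_sum _ fun i _ => measurable_const.indicator (hUm i)
  have hLm : ∀ i' v, MeasurableSet ({ω | ∑ i ∈ Finset.range i', (U i).indicator (fun _ => (1 : ℕ)) ω = v} : Set (BondConfig (Site d))) :=
    fun i' v => hNm i' (measurableSet_singleton v)
  have hLdet : ∀ i' v, DeterminedBy ({ω | ∑ i ∈ Finset.range i', (U i).indicator (fun _ => (1 : ℕ)) ω = v} : Set (BondConfig (Site d)))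
      (↑((box d (a (j + i') - 1)).sym2) : Set (Sym2 (Site d))) := by
    intro i' v
    rw [determinedBy_iff]
    intro ω ω' hωω'
    have hsum : ∑ i ∈ Finset.range i', (U i).indicator (fun _ => (1 : ℕ)) ω = ∑ i ∈ Finset.range i', (U i).indicator (fun _ => (1 : ℕ)) ω' := by
      refine Finset.sum_congr rfl fun i hi => ?_
      have hiff : ω ∈ U i ↔ ω' ∈ U i := (determinedBy_iff _ _).1 (hUdet i' i (Finset.mem_range.1 hi)) ω ω' hωω'
      by_cases hω : ω ∈ U i
      · rw [Set.indicator_of_mem hω, Set.indicator_of_mem (hiff.1 hω)]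
      · rw [Set.indicator_of_notMem hω, Set.indicator_of_notMem (fun h => hω (hiff.2 h))]
    simp only [Set.mem_setOf_eq, hsum]
  have hGdet' : ∀ i', DeterminedBy G (↑((box d (a (j + i') - 1)).sym2) : Set (Sym2 (Site d))) := fun i' =>
    hG.mono (Finset.coe_subset.2 (Finset.sym2_mono (box_mono d (Nat.sub_le_sub_right (hamono (Nat.le_add_right j i')) 1))))
  have hSm : MeasurableSet ({ω | ∑ i ∈ Finset.range k, (U i).indicator (fun _ => (1 : ℕ)) ω ≤ m} : Set (BondConfig (Site d))) :=
    hNm k (measurableSet_Iic : MeasurableSet (Set.Iic m))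
  -- the finite measure `ν(· ∩ G)`
  set ν' : Measure (BondConfig (Site d)) := ν.restrict G with hν'
  have hcond : ∀ i' v : ℕ, c * ν'.real {ω | ∑ i ∈ Finset.range i', (U i).indicator (fun _ => (1 : ℕ)) ω = v} ≤
      ν'.real ({ω | ∑ i ∈ Finset.range i', (U i).indicator (fun _ => (1 : ℕ)) ω = v} ∩ U i') := by
    intro i' v
    have h := iicMeasure_real_inter_annulusUniq_ge p hl hCU hν (ha1 (j + i')) ((hLdet i' v).inter (hGdet' i')) ((hLm i' v).inter hGm)
    rw [hν', measureReal_restrict_apply (hLm i' v), measureReal_restrict_apply ((hLm i' v).inter (hUm i'))]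
    calc c * ν.real ({ω | ∑ i ∈ Finset.range i', (U i).indicator (fun _ => (1 : ℕ)) ω = v} ∩ G)
        ≤ ν.real ({ω | ∑ i ∈ Finset.range i', (U i).indicator (fun _ => (1 : ℕ)) ω = v} ∩ G ∩ U i') := h
      _ = ν.real ({ω | ∑ i ∈ Finset.range i', (U i).indicator (fun _ => (1 : ℕ)) ω = v} ∩ U i' ∩ G) := by
          rw [Set.inter_right_comm]
  have h := measureReal_count_le_two_pow_mul_pow (ν := ν') U hUm (by linarith) hcond k m
  rw [hν', measureReal_restrict_apply hSm, measureReal_restrict_apply MeasurableSet.univ, Set.univ_inter] at h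
  rw [Set.inter_comm]
  exact h

/-- **FINITE VOLUME, QUENCHED**: under `CU⁺_l(c)`, for every `n`, every `j`, every measurable `G` determined by the pairs of `Λ(a_j − 1)` and
all `k, m`: **`P_p({0 ↔ ∂ⁱⁿΛ(n)} ∩ G ∩ {#{i<k : U(a_{j+i}, la_{j+i})} ≤ m}) ≤ 2^m (1 − c/2)^k · P_p({0 ↔ ∂ⁱⁿΛ(n)} ∩ G)`** — given the arm
AND anything about the cluster inside `Λ(a_j − 1)`, few glued annuli among the next `k` scales is exponentially unlikely. [cite: Kesten1986, §2] -/
theorem real_siteToBoundary_inter_inter_count_annulusUniq_le (p : unitInterval) {l : ℕ} (hl : 2 ≤ l) {c : ℝ}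
    (hCU : ∀ a : ℕ, 1 ≤ a → ∀ E : Set (BondConfig (Site d)), IsUpperSet E → MeasurableSet E →
      c * (bondPercolation (zdGraph d) p).real E ≤ (bondPercolation (zdGraph d) p).real (E ∩
        {ω : BondConfig (Site d) | ∀ t ∈ innerBoundary (zdGraph d) (box d a), ∀ s ∈ innerBoundary (zdGraph d) (box d (l * a)),
        ∀ t' ∈ innerBoundary (zdGraph d) (box d a), ∀ s' ∈ innerBoundary (zdGraph d) (box d (l * a)),
        ω ∈ openConnIn (↑((box d (l * a) \ box d a) ∪ innerBoundary (zdGraph d) (box d a)) : Set (Site d)) t s →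
        ω ∈ openConnIn (↑((box d (l * a) \ box d a) ∪ innerBoundary (zdGraph d) (box d a)) : Set (Site d)) t' s' →
        ω ∈ openConnIn (↑((box d (l * a) \ box d a) ∪ innerBoundary (zdGraph d) (box d a)) : Set (Site d)) s s'}))
    (a : ℕ → ℕ) (ha1 : ∀ i, 1 ≤ a i) (hnest : ∀ i, l * a i + 1 ≤ a (i + 1)) (n j : ℕ) {G : Set (BondConfig (Site d))}
    (hG : DeterminedBy G (↑((box d (a j - 1)).sym2) : Set (Sym2 (Site d)))) (hGm : MeasurableSet G) (k m : ℕ) :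
    (bondPercolation (zdGraph d) p).real (siteToBoundary d n ∩ G ∩ {ω | (∑ i ∈ Finset.range k, ({ω : BondConfig (Site d) | ∀ t ∈ innerBoundary (zdGraph d) (box d (a (j + i))), ∀ s ∈ innerBoundary (zdGraph d) (box d (l * a (j + i))),
        ∀ t' ∈ innerBoundary (zdGraph d) (box d (a (j + i))), ∀ s' ∈ innerBoundary (zdGraph d) (box d (l * a (j + i))),
        ω ∈ openConnIn (↑((box d (l * a (j + i)) \ box d (a (j + i))) ∪ innerBoundary (zdGraph d) (box d (a (j + i)))) : Set (Site d)) t s →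
        ω ∈ openConnIn (↑((box d (l * a (j + i)) \ box d (a (j + i))) ∪ innerBoundary (zdGraph d) (box d (a (j + i)))) : Set (Site d)) t' s' →
        ω ∈ openConnIn (↑((box d (l * a (j + i)) \ box d (a (j + i))) ∪ innerBoundary (zdGraph d) (box d (a (j + i)))) : Set (Site d)) s s'} : Set (BondConfig (Site d))).indicator (fun _ => (1 : ℕ)) ω) ≤ m}) ≤
      2 ^ m * (1 - c / 2) ^ k * (bondPercolation (zdGraph d) p).real (siteToBoundary d n ∩ G) := by
  set μ := bondPercolation (zdGraph d) p with hμ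
  set U : ℕ → Set (BondConfig (Site d)) := fun i => {ω : BondConfig (Site d) | ∀ t ∈ innerBoundary (zdGraph d) (box d (a (j + i))), ∀ s ∈ innerBoundary (zdGraph d) (box d (l * a (j + i))),
        ∀ t' ∈ innerBoundary (zdGraph d) (box d (a (j + i))), ∀ s' ∈ innerBoundary (zdGraph d) (box d (l * a (j + i))),
        ω ∈ openConnIn (↑((box d (l * a (j + i)) \ box d (a (j + i))) ∪ innerBoundary (zdGraph d) (box d (a (j + i)))) : Set (Site d)) t s →
        ω ∈ openConnIn (↑((box d (l * a (j + i)) \ box d (a (j + i))) ∪ innerBoundary (zdGraph d) (box d (a (j + i)))) : Set (Site d)) t' s' →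
        ω ∈ openConnIn (↑((box d (l * a (j + i)) \ box d (a (j + i))) ∪ innerBoundary (zdGraph d) (box d (a (j + i)))) : Set (Site d)) s s'} with hUdef
  -- `c ≤ 1`
  have hc1 : c ≤ 1 := by
    have h := hCU 1 le_rfl Set.univ isUpperSet_univ MeasurableSet.univ
    rw [probReal_univ, mul_one, Set.univ_inter] at h
    exact h.trans measureReal_le_one
  have hamono : Monotone a := monotone_nat_of_le_succ fun i => by nlinarith [hnest i, ha1 i]
  have hla : ∀ i i', i < i' → l * a i + 1 ≤ a i' := fun i i' hii' => (hnest i).trans (hamono (Nat.succ_le_of_lt hii'))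
  have hUm : ∀ i, MeasurableSet (U i) := fun i =>
    measurableSet_of_isLocalEvent_holds (isLocalEvent_annulusUniq (d := d) (by nlinarith [ha1 (j + i)]))
  have hUdet : ∀ i' i, i < i' → DeterminedBy (U i) (↑((box d (a (j + i') - 1)).sym2) : Set (Sym2 (Site d))) := by
    intro i' i hii'
    have h1 : l * a (j + i) ≤ a (j + i') - 1 := by have := hla (j + i) (j + i') (by omega); omega
    exact (determinedBy_annulusUniq (a (j + i)) (l * a (j + i)) (sym2_annulus_subset_sym2_box (by nlinarith [ha1 (j + i)]))).mono
      (Finset.coe_subset.2 (Finset.sym2_mono (box_mono d h1)))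
  have hNm : ∀ i', Measurable fun ω : BondConfig (Site d) => ∑ i ∈ Finset.range i', (U i).indicator (fun _ => (1 : ℕ)) ω :=
    fun i' => Finset.measurable_sum _ fun i _ => measurable_const.indicator (hUm i)
  have hLm : ∀ i' v, MeasurableSet ({ω | ∑ i ∈ Finset.range i', (U i).indicator (fun _ => (1 : ℕ)) ω = v} : Set (BondConfig (Site d))) :=
    fun i' v => hNm i' (measurableSet_singleton v)
  have hLdet : ∀ i' v, DeterminedBy ({ω | ∑ i ∈ Finset.range i', (U i).indicator (fun _ => (1 : ℕ)) ω = v} : Set (BondConfig (Site d)))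
      (↑((box d (a (j + i') - 1)).sym2) : Set (Sym2 (Site d))) := by
    intro i' v
    rw [determinedBy_iff]
    intro ω ω' hωω'
    have hsum : ∑ i ∈ Finset.range i', (U i).indicator (fun _ => (1 : ℕ)) ω = ∑ i ∈ Finset.range i', (U i).indicator (fun _ => (1 : ℕ)) ω' := by
      refine Finset.sum_congr rfl fun i hi => ?_
      have hiff : ω ∈ U i ↔ ω' ∈ U i := (determinedBy_iff _ _).1 (hUdet i' i (Finset.mem_range.1 hi)) ω ω' hωω'
      by_cases hω : ω ∈ U i
      · rw [Set.indicator_of_mem hω, Set.indicator_of_mem (hiff.1 hω)]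
      · rw [Set.indicator_of_notMem hω, Set.indicator_of_notMem (fun h => hω (hiff.2 h))]
    simp only [Set.mem_setOf_eq, hsum]
  have hGdet' : ∀ i', DeterminedBy G (↑((box d (a (j + i') - 1)).sym2) : Set (Sym2 (Site d))) := fun i' =>
    hG.mono (Finset.coe_subset.2 (Finset.sym2_mono (box_mono d (Nat.sub_le_sub_right (hamono (Nat.le_add_right j i')) 1))))
  have hSm : MeasurableSet ({ω | ∑ i ∈ Finset.range k, (U i).indicator (fun _ => (1 : ℕ)) ω ≤ m} : Set (BondConfig (Site d))) :=
    hNm k (measurableSet_Iic : MeasurableSet (Set.Iic m))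
  -- the finite measure `P_p(· ∩ A_n ∩ G)`
  set ν' : Measure (BondConfig (Site d)) := μ.restrict (siteToBoundary d n ∩ G) with hν'
  have hAGm : MeasurableSet (siteToBoundary d n ∩ G) := (measurableSet_siteToBoundary d n).inter hGm
  have hcond : ∀ i' v : ℕ, c * ν'.real {ω | ∑ i ∈ Finset.range i', (U i).indicator (fun _ => (1 : ℕ)) ω = v} ≤
      ν'.real ({ω | ∑ i ∈ Finset.range i', (U i).indicator (fun _ => (1 : ℕ)) ω = v} ∩ U i') := by
    intro i' v
    have h := real_siteToBoundary_inter_inter_annulusUniq_ge p hl hCU (n := n) (ha1 (j + i')) ((hLdet i' v).inter (hGdet' i'))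
      ((hLm i' v).inter hGm)
    rw [hν', measureReal_restrict_apply (hLm i' v), measureReal_restrict_apply ((hLm i' v).inter (hUm i'))]
    calc c * μ.real ({ω | ∑ i ∈ Finset.range i', (U i).indicator (fun _ => (1 : ℕ)) ω = v} ∩ (siteToBoundary d n ∩ G))
        = c * μ.real (siteToBoundary d n ∩ ({ω | ∑ i ∈ Finset.range i', (U i).indicator (fun _ => (1 : ℕ)) ω = v} ∩ G)) := by
          congr 2; ext ω; simp only [Set.mem_inter_iff]; tauto
      _ ≤ μ.real (siteToBoundary d n ∩ ({ω | ∑ i ∈ Finset.range i', (U i).indicator (fun _ => (1 : ℕ)) ω = v} ∩ G) ∩ U i') := h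
      _ = μ.real ({ω | ∑ i ∈ Finset.range i', (U i).indicator (fun _ => (1 : ℕ)) ω = v} ∩ U i' ∩ (siteToBoundary d n ∩ G)) := by
          congr 1; ext ω; simp only [Set.mem_inter_iff]; tauto
  have h := measureReal_count_le_two_pow_mul_pow (ν := ν') U hUm (by linarith) hcond k m
  rw [hν', measureReal_restrict_apply hSm, measureReal_restrict_apply MeasurableSet.univ, Set.univ_inter] at h
  rw [Set.inter_comm]
  exact h

end Summit.CriticalPhenomena.PercolationContinuityZ3.Theorems.Crossing

end
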